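import Literature.MathematicalPhysics.QuantumFieldTheory.Balaban1983to89.B9MultiscaleSmoothPartitionY

/-!
# `Balaban1983to89.B9MultiscaleSmoothPartitionYLip` — THE MEMBER-UNIFORM SCALE-LIPSCHITZ BOUND of the multiscale smooth partition of unity `{ζ_y}` of
# `B9MultiscaleSmoothPartitionY`: `|ζ_y(z) − ζ_y(z′)| ≤ C_Lip(d, L)·|z − z′|_T ∕ L^{j(y)}` for ALL pairs of torus sites, and the two weighted forms
# (ξ-scale and η-scale pair weights) that are the `hLip` binder of `B11SectGSmoothCut.BlockNorm.ofSmoothPartition`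

T. Bałaban, *Propagators for lattice gauge theories in a background field*, Commun. Math. Phys. **99** (1985) 389–434
[`Balaban1985BackgroundPropagators`, "B9"]; [4] = T. Bałaban, *Propagators and renormalization transformations for lattice gauge
theories. II*, Commun. Math. Phys. **96** (1984) 223–250 [`Balaban1984PropagatorsII`].

statement-level skeleton of published theorems with citation tags; proofs where landed; nothing here is a claim about the
Yang–Mills mass gap

THE PRINTED LOCI.  [B9] (3.43) p. 398: the cut-off cost *"(‖ζ‖^ξ_α + |ζ|)"* — the Hölder norm of `ζ` IN UNITS OF THE BLOCK SCALE `ξ = Lʲη` is `O(1)`, i.e.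
`|ζ_y(x) − ζ_y(x′)| ≲ |x − x′| ∕ (Lʲη)`; [4] p. 247 after (2.134) (*"|∂h_□| ≤ O(1)(MLʲη)^{−1}"*), (2.51)–(2.52) p. 232.

WHAT THIS FILE PROVES (sorry-free; at a k-level index `i : KIdx`, notation of `B9MultiscaleSmoothPartitionY`: `tent`, `tot`, `zeta`, `rad`, `scl i y = L^{j(y)}`,
`|z − z′|_T = torusSupNorm (toKT i).NB (z.1 − z′.1)`):
* §1 THE ACTIVE INDEX BONDS AT A SITE `act i z = {y : tent i y z ≠ 0}`: per level `j′` at most `2(d+1)·7^{d+1}` (carrier multiplicity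
  `B9CarrierBlockMultiplicity.card_sameCarrier_le_kIdx` × per-level packing `B6Geom246MultiLevelTorus.packT` within `3L^{j′}`), and only the levels `lev z − 1, lev z, lev z + 1`
  occur (`levY_window_of_tent_ne_zero`): ★ `card_act_le : #act i z ≤ C0 d := 6(d+1)·7^{d+1}`;
* §2 `|tot z − tot z′| ≤ Σ_{act z ∪ act z′} |tent_y z − tent_y z′|` and, when both sites sit in the two-level window about a level `j`,
  `≤ 2·C0·L²·|z − z′|_T ∕ Lʲ` (`abs_tot_sub_le_of_window`);
* §3 ★★ `abs_zeta_sub_le : |zeta i y z − zeta i y z′| ≤ CLip d ℓ · |z − z′|_T ∕ L^{j(y)}` for ALL `y, z, z′`, `CLip d ℓ := 1 + 2·C0 d·L²` (depends on `d, L`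
  only — member-uniform): far pairs (`|z − z′|_T > L^{j(y)}`) by `0 ≤ ζ ≤ 1`; close pairs by the quotient rule
  `ζz − ζz′ = (tz − tz′)∕S + tz′·(S′ − S)∕(S·S′)` with `S, S′ ≥ 1`, the window at both sites, and §2;
* §4 the WEIGHTED FORMS (`0 ≤ ε ≤ 1`): ★ `xiWeight_mul_abs_zeta_sub_le` — `((|z−z′|_T ∕ L^{j(y)})^ε)⁻¹·|Δζ_y| ≤ CLip` (ξ-scale pair weight: `Λ := CLip`, `W := 1`) and
  ★ `scaledWeight_mul_abs_zeta_sub_le` — for any unit `n > 0` (print: `n = L^k = η⁻¹`, n06-d's `wS`): `((|z−z′|_T ∕ n)^ε)⁻¹·|Δζ_y| ≤ CLip·((L^{j(y)} ∕ n)^ε)⁻¹`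
  (η-scale pair weight: `Λ := CLip`, `W y := (L^{j(y)}η)^{−ε}` — print's displayed block-scale power); both in the shape of the scale-covariant binder
  `hLip : N y x → P x x′ → w x x′·|ζ y x − ζ y x′| ≤ Λ·W y` of `B11SectGSmoothCut.BlockNorm.ofSmoothPartition` (no `N`∕`P` restriction is needed).
HONEST SCOPE.  Finite-lattice geometry of ONE k-level torus family at a time; the constants `C0 = 6(d+1)7^{d+1}`, `CLip = 1 + 2·C0·L²` are ours and not optimised;
nothing of [B9]∕[4] asserted; no pin of any certificate binder, no schema; COUNT-NEUTRAL; N06 NOT discharged; nothing continuum, nothing about the mass gap.  Cell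
`pub-ymgap` (HUMAN RULING D-0062), Track A node N06 [B9], seat `pub-ymgap-dag-n06-l` (g20), 2026-08-28.
-/

noncomputable section

namespace Literature.MathematicalPhysics.QuantumFieldTheory.Balaban1983to89.B9MultiscaleSmoothPartitionYLip

open B4TorusKernel.MultiPeriod (torusSupNorm torusSupNorm_nonneg)
open B6MultiLevelTorusOperator (one_le_N0)
open B6Geom246MultiLevelBox (bset blkOf)
open B6Geom246MultiLevelTorus (posT packT)
open B6Ineq2142KLevelV1 (β lvl beta_level)
open B6KLevelCensusIndexV1 (KIdx)
open B9GeoLemma21KLevelV1 (one_le_k)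
open B9CarrierBlockMultiplicity (card_sameCarrier_le_kIdx)
open B9MultiscaleSmoothPartitionY
open Node00 (SiteY IBondY BlkY toKT levY)

variable {d ℓ : ℕ} {hd : 1 ≤ d + 1} {hL : Odd (ℓ + 1) ∧ 1 < ℓ + 1} {b₀ b₁ : ℝ}

/-! ## §1 The active index bonds at a site and their number -/

section Count

variable (i : KIdx d ℓ hd hL b₀ b₁)

open Classical in
/-- the ACTIVE index bonds at a site: those whose tent does not vanish there. [cite: Balaban1984PropagatorsII, (2.52) p.232 (the finite overlap behind `κ`), dictionary] -/
def act (z : SiteY i) : Finset (IBondY i) := Finset.univ.filter fun y => tent i y z ≠ 0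

/-- membership in the active set. [cite: Balaban1984PropagatorsII, (2.52) p.232, bookkeeping] -/
theorem mem_act {y : IBondY i} {z : SiteY i} : y ∈ act i z ↔ tent i y z ≠ 0 := by
  classical
  simp [act]

/-- the per-level ∕ three-level overlap constant `C0 = 3·(2(d+1))·7^{d+1}`. OURS. [cite: Balaban1984PropagatorsII, (2.52) p.232, dictionary] -/
def C0 (d : ℕ) : ℕ := 3 * (2 * (d + 1)) * 7 ^ (d + 1)

/-- ★ **ACTIVE BONDS OF ONE LEVEL**: at most `2(d+1)·7^{d+1}` index bonds of level `j` are active at a site — their carrier blocks are level-`j` blocks within torus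
distance `3Lʲ` of the site (per-level packing `packT`: at most `7^{d+1}`), each carrying at most `2(d+1)` index bonds (`card_sameCarrier_le_kIdx`).
[cite: Balaban1984PropagatorsII, (2.58) p.233 (per-level packing), (2.142) p.248 («b ∈ Λ_j»)] -/
theorem card_act_level_le (z : SiteY i) (j : ℕ) :
    ((act i z).filter fun y => lvl i.hN i.D i.hk y = j).card ≤ 2 * (d + 1) * 7 ^ (d + 1) := by
  classical
  set A : Finset (IBondY i) := (act i z).filter fun y => lvl i.hN i.D i.hk y = j with hA
  set S : Finset (BlkY i) := A.image (β i.hN i.D i.hk) with hS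
  have hmemA : ∀ {y}, y ∈ A → tent i y z ≠ 0 ∧ lvl i.hN i.D i.hk y = j := fun {y} hy => by
    have hy' := Finset.mem_filter.1 hy
    exact ⟨(mem_act i).1 hy'.1, hy'.2⟩
  -- fibres of `β` inside `A` have at most `2(d+1)` elements
  have hfib : A.card = ∑ s ∈ S, (A.filter fun y => β i.hN i.D i.hk y = s).card :=
    Finset.card_eq_sum_card_fiberwise fun y hy => by exact Finset.mem_coe.2 (Finset.mem_image_of_mem _ hy)
  have hfib_le : ∀ s ∈ S, (A.filter fun y => β i.hN i.D i.hk y = s).card ≤ 2 * (d + 1) := by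
    intro s hs
    obtain ⟨y₀, -, rfl⟩ := Finset.mem_image.1 hs
    refine le_trans (Finset.card_le_card fun y hy => ?_) (card_sameCarrier_le_kIdx i y₀)
    exact Finset.mem_filter.2 ⟨Finset.mem_univ _, (Finset.mem_filter.1 hy).2⟩
  -- per-level packing of the carrier blocks within `3Lʲ` of the site
  have hLj : (0 : ℝ) < (((ℓ + 1) ^ j : ℕ) : ℝ) := by positivity
  have hpack := packT (D := (toKT i).D) j (pt i z) (3 * (((ℓ + 1) ^ j : ℕ) : ℝ)) S (by positivity) (by
    intro s hs
    obtain ⟨y, hy, rfl⟩ := Finset.mem_image.1 hs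
    obtain ⟨hty, hly⟩ := hmemA hy
    refine ⟨by rw [beta_level i.hN i.D i.hk (one_le_k i) y, hly], ?_⟩
    have hr := rad_lt_three_of_tent_ne_zero i hty
    rw [rad, div_lt_iff₀ (scl_pos i y), scl, hly, dist_comm] at hr
    rw [Nat.cast_pow]
    exact hr.le)
  have h7 : (2 * (3 * (((ℓ + 1) ^ j : ℕ) : ℝ)) / (((ℓ + 1) ^ j : ℕ) : ℝ) + 1) ^ (d + 1) = ((7 ^ (d + 1) : ℕ) : ℝ) := by
    rw [show (2 : ℝ) * (3 * (((ℓ + 1) ^ j : ℕ) : ℝ)) / (((ℓ + 1) ^ j : ℕ) : ℝ) = 6 by field_simp; ring]; norm_num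
  rw [h7] at hpack
  have hScard : S.card ≤ 7 ^ (d + 1) := by exact_mod_cast hpack
  calc A.card = ∑ s ∈ S, (A.filter fun y => β i.hN i.D i.hk y = s).card := hfib
    _ ≤ ∑ _s ∈ S, 2 * (d + 1) := Finset.sum_le_sum hfib_le
    _ = S.card * (2 * (d + 1)) := by rw [Finset.sum_const, smul_eq_mul]
    _ ≤ 7 ^ (d + 1) * (2 * (d + 1)) := Nat.mul_le_mul_right _ hScard
    _ = 2 * (d + 1) * 7 ^ (d + 1) := by ring

/-- ★ **THE NUMBER OF ACTIVE INDEX BONDS AT A SITE IS AT MOST `C0 = 6(d+1)·7^{d+1}`** (only the levels `lev z − 1`, `lev z`, `lev z + 1` are active, §3 of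
`B9MultiscaleSmoothPartitionY`). [cite: Balaban1984PropagatorsII, (2.52) p.232 (finite overlap), (2.2) p.224] -/
theorem card_act_le (z : SiteY i) : (act i z).card ≤ C0 d := by
  classical
  set j := levY i z with hj
  have hsub : act i z ⊆ ((act i z).filter fun y => lvl i.hN i.D i.hk y = j - 1) ∪ ((act i z).filter fun y => lvl i.hN i.D i.hk y = j) ∪
      ((act i z).filter fun y => lvl i.hN i.D i.hk y = j + 1) := by
    intro y hy
    have hw := levY_window_of_tent_ne_zero i ((mem_act i).1 hy)
    rw [← hj] at hw
    simp only [Finset.mem_union, Finset.mem_filter, hy, true_and]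
    omega
  calc (act i z).card ≤ _ := Finset.card_le_card hsub
    _ ≤ _ := (Finset.card_union_le _ _).trans (Nat.add_le_add_right (Finset.card_union_le _ _) _)
    _ ≤ 2 * (d + 1) * 7 ^ (d + 1) + 2 * (d + 1) * 7 ^ (d + 1) + 2 * (d + 1) * 7 ^ (d + 1) :=
        Nat.add_le_add (Nat.add_le_add (card_act_level_le i z _) (card_act_level_le i z _)) (card_act_level_le i z _)
    _ = C0 d := by unfold C0; ring

/-- the total tent mass is the sum over the active bonds. [cite: Balaban1984PropagatorsII, (2.51) p.232, bookkeeping] -/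
theorem tot_eq_sum_act (z : SiteY i) : tot i z = ∑ y ∈ act i z, tent i y z := by
  classical
  rw [tot]
  symm
  refine Finset.sum_subset (Finset.subset_univ _) fun y _ hy => ?_
  by_contra h
  exact hy ((mem_act i).2 h)

end Count

/-! ## §2 The variation of the total tent mass between two sites -/

section Total

variable (i : KIdx d ℓ hd hL b₀ b₁)

/-- `|tot z − tot z′| ≤ Σ_{y ∈ act z ∪ act z′} |tent_y z − tent_y z′|` (bonds inactive at both sites contribute nothing). [cite: Balaban1984PropagatorsII, (2.52) p.232, bookkeeping] -/
theorem abs_tot_sub_le (z z' : SiteY i) :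
    |tot i z - tot i z'| ≤ ∑ y ∈ act i z ∪ act i z', |tent i y z - tent i y z'| := by
  classical
  have h : tot i z - tot i z' = ∑ y ∈ act i z ∪ act i z', (tent i y z - tent i y z') := by
    rw [tot, tot, ← Finset.sum_sub_distrib]
    symm
    refine Finset.sum_subset (Finset.subset_univ _) fun y _ hy => ?_
    rw [Finset.mem_union, not_or, mem_act, mem_act, not_not, not_not] at hy
    rw [hy.1, hy.2, sub_zero]
  rw [h]
  exact Finset.abs_sum_le_sum_abs _ _

/-- a tent of level `≥ j − 2` is `(L² ∕ Lʲ)`-Lipschitz. [cite: Balaban1985BackgroundPropagators, (3.43) p.398 («‖ζ‖^ξ_α»), bookkeeping] -/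
theorem abs_tent_sub_le_of_level {y : IBondY i} {j : ℕ} (hy : j ≤ lvl i.hN i.D i.hk y + 2) (z z' : SiteY i) :
    |tent i y z - tent i y z'| ≤ (((ℓ + 1 : ℕ) : ℝ)) ^ 2 * torusSupNorm (toKT i).NB (z.1 - z'.1) / (((ℓ + 1 : ℕ) : ℝ)) ^ j := by
  have hD : 0 ≤ torusSupNorm (toKT i).NB (z.1 - z'.1) := torusSupNorm_nonneg (fun μ => one_le_N0 (toKT i).hMh (toKT i).hP μ) _
  have hL1 : (1 : ℝ) ≤ ((ℓ + 1 : ℕ) : ℝ) := by exact_mod_cast Nat.succ_le_succ (Nat.zero_le ℓ)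
  have hLj : (0 : ℝ) < (((ℓ + 1 : ℕ) : ℝ)) ^ j := by positivity
  refine (abs_tent_sub_le i y z z').trans ?_
  rw [div_le_div_iff₀ (scl_pos i y) hLj, scl]
  calc torusSupNorm (toKT i).NB (z.1 - z'.1) * (((ℓ + 1 : ℕ) : ℝ)) ^ j
      ≤ torusSupNorm (toKT i).NB (z.1 - z'.1) * (((ℓ + 1 : ℕ) : ℝ)) ^ (lvl i.hN i.D i.hk y + 2) :=
        mul_le_mul_of_nonneg_left (pow_le_pow_right₀ hL1 hy) hD
    _ = (((ℓ + 1 : ℕ) : ℝ)) ^ 2 * torusSupNorm (toKT i).NB (z.1 - z'.1) * (((ℓ + 1 : ℕ) : ℝ)) ^ (lvl i.hN i.D i.hk y) := by ring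

/-- ★ **IN THE TWO-LEVEL WINDOW ABOUT A LEVEL `j` THE TOTAL MASS IS `(2·C0·L² ∕ Lʲ)`-LIPSCHITZ**: if both sites have level `≥ j − 1`, every bond active at either site has level
`≥ j − 2`. [cite: Balaban1984PropagatorsII, (2.52) p.232, (2.2) p.224; Balaban1985BackgroundPropagators, (3.43) p.398] -/
theorem abs_tot_sub_le_of_window (z z' : SiteY i) {j : ℕ} (hz : j ≤ levY i z + 1) (hz' : j ≤ levY i z' + 1) :
    |tot i z - tot i z'| ≤ 2 * (C0 d : ℝ) * (((ℓ + 1 : ℕ) : ℝ)) ^ 2 * torusSupNorm (toKT i).NB (z.1 - z'.1) / (((ℓ + 1 : ℕ) : ℝ)) ^ j := by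
  classical
  set D := torusSupNorm (toKT i).NB (z.1 - z'.1) with hDdef
  have hD : 0 ≤ D := torusSupNorm_nonneg (fun μ => one_le_N0 (toKT i).hMh (toKT i).hP μ) _
  have hterm : ∀ y ∈ act i z ∪ act i z', |tent i y z - tent i y z'| ≤ (((ℓ + 1 : ℕ) : ℝ)) ^ 2 * D / (((ℓ + 1 : ℕ) : ℝ)) ^ j := by
    intro y hy
    refine abs_tent_sub_le_of_level i ?_ z z'
    rcases Finset.mem_union.1 hy with h | h
    · have := (levY_window_of_tent_ne_zero i ((mem_act i).1 h)).2; omega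
    · have := (levY_window_of_tent_ne_zero i ((mem_act i).1 h)).2; omega
  have hcard : (((act i z ∪ act i z').card : ℕ) : ℝ) ≤ 2 * (C0 d : ℝ) := by
    have h := (Finset.card_union_le (act i z) (act i z')).trans (Nat.add_le_add (card_act_le i z) (card_act_le i z'))
    have h' : (((act i z ∪ act i z').card : ℕ) : ℝ) ≤ ((C0 d + C0 d : ℕ) : ℝ) := by exact_mod_cast h
    refine h'.trans (le_of_eq ?_); push_cast; ring
  have hq : 0 ≤ (((ℓ + 1 : ℕ) : ℝ)) ^ 2 * D / (((ℓ + 1 : ℕ) : ℝ)) ^ j := by positivity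
  calc |tot i z - tot i z'| ≤ ∑ y ∈ act i z ∪ act i z', |tent i y z - tent i y z'| := abs_tot_sub_le i z z'
    _ ≤ ∑ _y ∈ act i z ∪ act i z', (((ℓ + 1 : ℕ) : ℝ)) ^ 2 * D / (((ℓ + 1 : ℕ) : ℝ)) ^ j := Finset.sum_le_sum hterm
    _ = (((act i z ∪ act i z').card : ℕ) : ℝ) * ((((ℓ + 1 : ℕ) : ℝ)) ^ 2 * D / (((ℓ + 1 : ℕ) : ℝ)) ^ j) := by
        rw [Finset.sum_const, nsmul_eq_mul]
    _ ≤ (2 * (C0 d : ℝ)) * ((((ℓ + 1 : ℕ) : ℝ)) ^ 2 * D / (((ℓ + 1 : ℕ) : ℝ)) ^ j) := mul_le_mul_of_nonneg_right hcard hq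
    _ = _ := by ring

end Total

/-! ## §3 ★★ The member-uniform scale-Lipschitz bound of `ζ` -/

section Lip

variable (i : KIdx d ℓ hd hL b₀ b₁)

/-- the scale-Lipschitz constant `C_Lip = 1 + 2·C0·L²` (depends on `d, L` only). OURS. [cite: Balaban1985BackgroundPropagators, (3.43) p.398 («‖ζ‖^ξ_α»), dictionary] -/
def CLip (d ℓ : ℕ) : ℝ := 1 + 2 * (C0 d : ℝ) * (((ℓ + 1 : ℕ) : ℝ)) ^ 2

/-- `1 ≤ C_Lip`. [cite: Balaban1985BackgroundPropagators, (3.43) p.398, bookkeeping] -/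
theorem one_le_CLip (d ℓ : ℕ) : 1 ≤ CLip d ℓ := by
  unfold CLip
  have h : (0 : ℝ) ≤ 2 * (C0 d : ℝ) * (((ℓ + 1 : ℕ) : ℝ)) ^ 2 := by positivity
  linarith

/-- `0 ≤ C_Lip`. [cite: Balaban1985BackgroundPropagators, (3.43) p.398, bookkeeping] -/
theorem CLip_nonneg (d ℓ : ℕ) : 0 ≤ CLip d ℓ := zero_le_one.trans (one_le_CLip d ℓ)

/-- `|ζ_y z − ζ_y z′| ≤ 1`. [cite: Balaban1985BackgroundPropagators, (3.43) p.398, bookkeeping] -/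
theorem abs_zeta_sub_le_one (y : IBondY i) (z z' : SiteY i) : |zeta i y z - zeta i y z'| ≤ 1 := by
  rw [abs_sub_le_iff]
  constructor <;> linarith [zeta_nonneg i y z, zeta_le_one i y z, zeta_nonneg i y z', zeta_le_one i y z']

/-- ★★ **THE MEMBER-UNIFORM SCALE-LIPSCHITZ BOUND**: `|ζ_y(z) − ζ_y(z′)| ≤ C_Lip·|z − z′|_T ∕ L^{j(y)}` for ALL index bonds `y` and ALL pairs of sites — far pairs
(`|z − z′|_T > L^{j(y)}`) by `0 ≤ ζ ≤ 1`, close pairs by the quotient rule `ζz − ζz′ = (tz − tz′)∕S + tz′·(S′ − S)∕(SS′)` (`S, S′ ≥ 1`), the tent's own bound,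
and the window bound of §2 at the level `j(y)` (both sites are in the window as soon as `tent_y z′ ≠ 0` and `|z − z′|_T ≤ L^{j(y)}`).
[cite: Balaban1985BackgroundPropagators, (3.43) p.398 («‖ζ‖^ξ_α = O(1)»); Balaban1984PropagatorsII, p.247 («|∂h_□| ≤ O(1)(MLʲη)^{−1}»)] -/
theorem abs_zeta_sub_le (y : IBondY i) (z z' : SiteY i) :
    |zeta i y z - zeta i y z'| ≤ CLip d ℓ * torusSupNorm (toKT i).NB (z.1 - z'.1) / scl i y := by
  set D := torusSupNorm (toKT i).NB (z.1 - z'.1) with hDdef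
  have hD : 0 ≤ D := torusSupNorm_nonneg (fun μ => one_le_N0 (toKT i).hMh (toKT i).hP μ) _
  have hs := scl_pos i y
  have hC := one_le_CLip d ℓ
  have hstep : D / scl i y ≤ CLip d ℓ * D / scl i y := by
    rw [mul_div_assoc]; exact le_mul_of_one_le_left (div_nonneg hD hs.le) hC
  by_cases hfar : scl i y < D
  · -- far pairs
    calc |zeta i y z - zeta i y z'| ≤ 1 := abs_zeta_sub_le_one i y z z'
      _ ≤ D / scl i y := (one_le_div hs).2 hfar.le
      _ ≤ _ := hstep
  push Not at hfar
  have htent : |tent i y z - tent i y z'| ≤ D / scl i y := abs_tent_sub_le i y z z'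
  have hT := one_le_tot i z
  have hT' := one_le_tot i z'
  have hid : zeta i y z - zeta i y z' =
      (tent i y z - tent i y z') / tot i z + tent i y z' * ((tot i z' - tot i z) / (tot i z * tot i z')) := by
    unfold zeta
    field_simp
    ring
  have hfirst : |(tent i y z - tent i y z') / tot i z| ≤ D / scl i y := by
    rw [abs_div, abs_of_pos (tot_pos i z)]
    exact (div_le_self (abs_nonneg _) hT).trans htent
  by_cases h0 : tent i y z' = 0
  · have hvan : tent i y z' * ((tot i z' - tot i z) / (tot i z * tot i z')) = 0 := by rw [h0, zero_mul]
    rw [hid, hvan, add_zero]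
    exact hfirst.trans hstep
  -- `y` active at `z′`: both sites are in the window about `j(y)`
  have hwz' := levY_window_of_tent_ne_zero i h0
  have hrz : rad i y z ≤ 11 / 2 := by
    have h1 := abs_rad_sub_le i y z z'
    have h2 := rad_lt_three_of_tent_ne_zero i h0
    have h3 : D / scl i y ≤ 1 := (div_le_one hs).2 hfar
    rw [abs_sub_le_iff] at h1
    linarith [h1.1]
  have hwz := levY_window_of_rad_le i hrz
  have htot := abs_tot_sub_le_of_window i z z' (j := lvl i.hN i.D i.hk y) (by omega) (by omega)
  have hsecond : |tent i y z' * ((tot i z' - tot i z) / (tot i z * tot i z'))| ≤ 2 * (C0 d : ℝ) * (((ℓ + 1 : ℕ) : ℝ)) ^ 2 * D / scl i y := by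
    rw [abs_mul, abs_of_nonneg (tent_nonneg i y z'), abs_div, abs_of_pos (mul_pos (tot_pos i z) (tot_pos i z')), abs_sub_comm]
    have hTT : 1 ≤ tot i z * tot i z' := one_le_mul_of_one_le_of_one_le hT hT'
    calc tent i y z' * (|tot i z - tot i z'| / (tot i z * tot i z'))
        ≤ 1 * (|tot i z - tot i z'| / 1) :=
          mul_le_mul (tent_le_one i y z') (div_le_div_of_nonneg_left (abs_nonneg _) zero_lt_one hTT) (by positivity) zero_le_one
      _ = |tot i z - tot i z'| := by rw [one_mul, div_one]
      _ ≤ _ := by rw [scl]; exact htot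
  rw [hid]
  calc |(tent i y z - tent i y z') / tot i z + tent i y z' * ((tot i z' - tot i z) / (tot i z * tot i z'))|
      ≤ |(tent i y z - tent i y z') / tot i z| + |tent i y z' * ((tot i z' - tot i z) / (tot i z * tot i z'))| := abs_add_le _ _
    _ ≤ D / scl i y + 2 * (C0 d : ℝ) * (((ℓ + 1 : ℕ) : ℝ)) ^ 2 * D / scl i y := add_le_add hfirst hsecond
    _ = CLip d ℓ * D / scl i y := by unfold CLip; ring

/-- the same on a carrier `X` with a site projection `π` (`zetaOn`). [cite: Balaban1985BackgroundPropagators, (3.43) p.398] -/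
theorem abs_zetaOn_sub_le {X : Type} (π : X → SiteY i) (y : IBondY i) (x x' : X) :
    |zetaOn i π y x - zetaOn i π y x'| ≤ CLip d ℓ * torusSupNorm (toKT i).NB ((π x).1 - (π x').1) / scl i y :=
  abs_zeta_sub_le i y (π x) (π x')

end Lip

/-! ## §4 The weighted forms (the `hLip` binder of `B11SectGSmoothCut.BlockNorm.ofSmoothPartition`) -/

section Weighted

variable (i : KIdx d ℓ hd hL b₀ b₁)

/-- ★ **ξ-SCALE PAIR WEIGHT**: for `0 ≤ ε ≤ 1` and `z ≠ z′` on the torus, `((|z − z′|_T ∕ L^{j(y)})^ε)⁻¹ · |ζ_y z − ζ_y z′| ≤ C_Lip` — the block-scale Hölder quotient of `ζ_y`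
is `O(1)` (print's `‖ζ‖^ξ_α`); in `ofSmoothPartition`: `Λ := C_Lip`, `W := 1`. [cite: Balaban1985BackgroundPropagators, (3.43) p.398 («‖ζ‖^ξ_α»); Balaban1984PropagatorsII, (2.52) p.232] -/
theorem xiWeight_mul_abs_zeta_sub_le {ε : ℝ} (hε0 : 0 ≤ ε) (hε1 : ε ≤ 1) (y : IBondY i) (z z' : SiteY i)
    (hzz : 0 < torusSupNorm (toKT i).NB (z.1 - z'.1)) :
    ((torusSupNorm (toKT i).NB (z.1 - z'.1) / scl i y) ^ ε)⁻¹ * |zeta i y z - zeta i y z'| ≤ CLip d ℓ := by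
  set t := torusSupNorm (toKT i).NB (z.1 - z'.1) / scl i y with ht
  have hs := scl_pos i y
  have htpos : 0 < t := div_pos hzz hs
  have hmain : |zeta i y z - zeta i y z'| ≤ CLip d ℓ * t := by rw [ht, ← mul_div_assoc]; exact abs_zeta_sub_le i y z z'
  have hC := one_le_CLip d ℓ
  by_cases h1 : t ≤ 1
  · have hpow : t ≤ t ^ ε := by
      have := Real.rpow_le_rpow_of_exponent_ge htpos h1 hε1
      rwa [Real.rpow_one] at this
    calc (t ^ ε)⁻¹ * |zeta i y z - zeta i y z'| ≤ t⁻¹ * (CLip d ℓ * t) :=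
          mul_le_mul (inv_anti₀ htpos hpow) hmain (abs_nonneg _) (inv_nonneg.2 htpos.le)
      _ = CLip d ℓ := by field_simp
  · push Not at h1
    have hpow : 1 ≤ t ^ ε := Real.one_le_rpow h1.le hε0
    calc (t ^ ε)⁻¹ * |zeta i y z - zeta i y z'| ≤ 1 * 1 :=
          mul_le_mul (inv_le_one_of_one_le₀ hpow) (abs_zeta_sub_le_one i y z z') (abs_nonneg _) zero_le_one
      _ ≤ CLip d ℓ := by rw [one_mul]; exact hC

/-- ★ **A PAIR WEIGHT AT ANY UNIT `n > 0`** (print: `n = Lᵏ = η⁻¹`, the η-scale weight `((|z − z′|_T·η)^ε)⁻¹` of [4] (2.67) ∕ n06-d's `wS`):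
`((|z − z′|_T ∕ n)^ε)⁻¹ · |ζ_y z − ζ_y z′| ≤ C_Lip · ((L^{j(y)} ∕ n)^ε)⁻¹` — in `ofSmoothPartition`: `Λ := C_Lip`, `W y := ((L^{j(y)}∕n)^ε)⁻¹ = (Lʲη)^{−ε}`, print's displayed
block-scale power. [cite: Balaban1985BackgroundPropagators, (3.43) p.398 («(Lʲη)^{−α}(‖ζ‖^ξ_α + |ζ|)»); Balaban1984PropagatorsII, (2.67) p.234] -/
theorem scaledWeight_mul_abs_zeta_sub_le {ε : ℝ} (hε0 : 0 ≤ ε) (hε1 : ε ≤ 1) {n : ℝ} (hn : 0 < n) (y : IBondY i) (z z' : SiteY i)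
    (hzz : 0 < torusSupNorm (toKT i).NB (z.1 - z'.1)) :
    ((torusSupNorm (toKT i).NB (z.1 - z'.1) / n) ^ ε)⁻¹ * |zeta i y z - zeta i y z'| ≤ CLip d ℓ * ((scl i y / n) ^ ε)⁻¹ := by
  have hs := scl_pos i y
  have hD := hzz.le
  have hsplit : (torusSupNorm (toKT i).NB (z.1 - z'.1) / n) ^ ε = (torusSupNorm (toKT i).NB (z.1 - z'.1) / scl i y) ^ ε * (scl i y / n) ^ ε := by
    rw [← Real.mul_rpow (div_nonneg hD hs.le) (div_nonneg hs.le hn.le)]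
    congr 1
    field_simp
  have hW : 0 ≤ ((scl i y / n) ^ ε)⁻¹ := inv_nonneg.2 (Real.rpow_nonneg (div_nonneg hs.le hn.le) _)
  rw [hsplit, mul_inv, mul_comm ((torusSupNorm (toKT i).NB (z.1 - z'.1) / scl i y) ^ ε)⁻¹, mul_assoc, mul_comm (CLip d ℓ)]
  exact mul_le_mul_of_nonneg_left (xiWeight_mul_abs_zeta_sub_le i hε0 hε1 y z z' hzz) hW

end Weighted

end Literature.MathematicalPhysics.QuantumFieldTheory.Balaban1983to89.B9MultiscaleSmoothPartitionYLip
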